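import Summits.CriticalPhenomena.Ising3D.Control2DL15TwoSided096
import Summits.CriticalPhenomena.Ising3D.Control2DL15BoxT
import Summits.CriticalPhenomena.Ising3D.Control2DL15GapB
import Mathlib.Tactic.NormNum
import HarnessLib

/-!
# The class-1 2D control in the kernel at Λ = 15 on BOTH sides: `0.97 < Δ_ε < 1.0001` at `Δ_σ = 1/8` under `A2D′`, no window
(cell `pub-ising3x`, seat controls-1 gen 18; KERNEL PATH for the 2D γ-certificates, Λ ≤ 15 class-1 cover — CONTROL-ONLY)

HONEST FRAMING: lottery ticket; floor = tightest certified 3D Ising CFT bounds; no exact-solution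
claim without a proof. CONTROL-ONLY (`d = 2`, `Δ_σ = 1/8`, axiom set `A2D′`); nothing about `d = 3`; weaker than the
reader-certified statement of record (`0.99 < Δ_ε < 1.00005`, Λ = 19, readers A ∧ B).

Three more Λ = 15 / E₀ = 40 certificates, kernel-complete in the FLAT layout (`Control2DCellGroups`):
the RB-3 box S `[19/20, 24/25]` (`j117772`, `Control2DL15BoxS`, cover `Control2DL15TwoSided096`), the RB-4 box T `[24/25, 97/100]` (`j127795`,
`Control2DL15BoxT`) and the RB-4 GAP certificate B (`j127924`: `Δ_ε < 1.0001`, `Control2DL15GapB`, which replaces the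
Λ = 11 gap `1.0006` on the upper side):
* `excludedOn_2d_cover097 : ExcludedOn (1/8) 2 1 (Icc 0 (97/100))` (box T appended to `excludedOn_2d_cover096`);
* `twoSided_2d_kernel097 (w) : TwoSided (1/8) 2 1 w (97/100) (10001/10000)` for EVERY real `w` — under `A2D′` at
  `Δ_σ = 1/8` the `ε` location satisfies `0.97 < Δ_ε < 1.0001` (2D Ising: `Δ_ε = 1`), every obligation of every
  certificate re-decided by the Lean kernel (this is the reader-certified RB-4 statement of record `cover_v11.json` up to its
  last box `[0.97, 0.975]`, box U, `Control2DL15TwoSided0975`). No facts, standard axioms only.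
-/

namespace Summit.CriticalPhenomena.Ising3D.Control2D

open Set
open Literature.MathematicalPhysics.QuantumFieldTheory.ConformalBootstrap3D

/-- **Kernel-complete cover of the `ε` locations `[0, 97/100]`** at `Δ_σ = 1/8` under `A2D′` (box T appended).
CONTROL-ONLY (d = 2). [cite: RattazziEtAl2008, §5.5] -/
theorem excludedOn_2d_cover097 : ExcludedOn (1 / 8 : ℝ) 2 1 (Icc (0 : ℝ) (97 / 100)) :=
  excludedOn_Icc_append excludedOn_2d_cover096 excludedOn_2d_L15_boxT le_rfl

/-- **2D control, class 1, kernel-complete at Λ = 15 on both sides, for EVERY window parameter `w`**: under `A2D′`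
at `Δ_σ = 1/8` the `ε` location satisfies `97/100 < Δ_ε < 10001/10000`. CONTROL-ONLY (d = 2).
[cite: RattazziEtAl2008, §5.5] -/
theorem twoSided_2d_kernel097 (w : ℝ) : TwoSided (1 / 8 : ℝ) 2 1 w (97 / 100) (10001 / 10000) :=
  twoSided_of_cover_zero excludedOn_2d_cover097 gapExcluded_2d_L15_gapB (by norm_num) w

end Summit.CriticalPhenomena.Ising3D.Control2D
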